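import Summits.QuantumFields.YangMills.Theses.OneCertifiedCube

/-!
# `OneCertifiedCube.Assembly` — the assembly item of route `OneCertifiedCube`

Route `OneCertifiedCube` (sub-problem `YangMills` of summit `QuantumFields`) files, as its assembly
item `Assembly` (stmt-QuantumFields-8898), the implication chain

`FiniteSizeCriterion → ContinuumLimitExists → CrossoverCertificate → GapToContinuum → YangMills`.

This is *verbatim* the type of the route's deciding theorem
`Summit.QuantumFields.YangMills.Theses.OneCertifiedCube.closes` (planner-authored, sorry-free,
kernel-checked with the route file): fix `G` compact simple with its Borel σ-algebra;
`ContinuumLimitExists` gives `(r, sch, T)` with `IsYangMillsFor r sch T`, non-triviality and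
non-Gaussianity of the curvature field; `CrossoverCertificate` gives the physical length `ℓ > 0`,
`n ≥ 1`, `ε ≥ 0` with `ε · M(n) < 1` and, eventually in `k`, the total-variation finite-size
condition at block size `b_k = ⌈ℓ / a_k⌉₊`; `FiniteSizeCriterion` turns `(n, ε)` into a rate
`κ > 0` and, for each pair of local gauge-invariant observables, a constant `C` uniform in
`β, b, S, t`; with `Δ := κ / (2ℓ)`, eventually `a_k ≤ ℓ` (so `b_k · a_k ≤ 2ℓ` and
`e^{-κ t / b_k} ≤ e^{-Δ a_k t}`) and `(8n+7) b_k ≤ 2 L_k + 1` (from `a_k L_k → ∞`), whence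
`HasLatticeMassGap r sch Δ`; `GapToContinuum` upgrades it to `T.HasMassGap Δ` — the body of
`YangMills` for `G`. This file closes the item by that definitional unfolding; it adds no
mathematics of its own.

Sources: route-internal (the deciding theorem `closes`); Jaffe–Witten 2000 for the axioms packaged
in `YangMills`; Dobrushin–Shlosman 1985 for the finite-size-criterion mechanism the cruxes describe.
Deliberately NOT here: any of the cruxes (`FiniteSizeCriterion`, `ContinuumLimitExists`,
`CrossoverCertificate`, `GapToContinuum`) or the support `SU2OneCube` — they stay open items of
the route.
-/

namespace Summit.QuantumFields.YangMills.Theorems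

/-- **`OneCertifiedCube.Assembly` holds** (assembly item stmt-QuantumFields-8898): the chain
`FiniteSizeCriterion → ContinuumLimitExists → CrossoverCertificate → GapToContinuum → YangMills`.
Proof: after unfolding, the goal is literally the type of the route's sorry-free deciding theorem
`OneCertifiedCube.closes` (rate `Δ = κ / (2ℓ)`, block size `⌈ℓ / a_k⌉₊`, `Filter.Eventually`
bookkeeping for `a_k ≤ ℓ` and `(8n+7)ℓ ≤ a_k L_k`). [folklore] -/
theorem oneCertifiedCube_assembly_proof :
    Summit.QuantumFields.YangMills.Theses.OneCertifiedCube.Assembly := by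
  unfold Summit.QuantumFields.YangMills.Theses.OneCertifiedCube.Assembly
  exact Summit.QuantumFields.YangMills.Theses.OneCertifiedCube.closes

end Summit.QuantumFields.YangMills.Theorems
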